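import Mathlib.Analysis.Calculus.LocalExtr.Basic
import Mathlib.Analysis.Normed.Module.FiniteDimension
import Mathlib.Topology.Compactness.Compact
import Mathlib.Topology.Order.Compact
import Mathlib.MeasureTheory.Constructions.BorelSpace.Basic
import HarnessLib

/-!
# The PARAMETRIC STRONGLY-CONVEX MINIMISER: existence, interiority, uniqueness, a-priori bound, stability, and
# CONTINUITY in the parameter (hence measurability) — the implicit fibre minimiser of the fibred Laplace road
# (free-hands support of ⟨stmt-QuantumFields-24197⟩ `SwapVirialDeficit.SwapGluedStiffness`; generic, companion of
# ✓`SwapVirialDeficitQuantitativeLaplaceFibred{,Chart,Taylor}`)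

Generic real analysis (namespace `Summit.QuantumFields.YangMills.Theorems.QuantitativeLaplace`).  `V` a finite-dimensional real normed
space, `F : V → ℝ` continuous on the closed ball `B̄(0,ρ)` and STRONGLY CONVEX there in the first-order form
`F(x₀) + DF(x₀)[x − x₀] + (λ/2)‖x − x₀‖² ≤ F(x)` (`x₀, x ∈ B̄(0,ρ)`; `DF = fderiv`, which is `0` where `F` is not differentiable — the
inequality is then a plain quadratic-growth statement), with the centre almost critical: `‖DF(0)‖ < λρ/2`.  Then
* ★ `exists_minimiser_of_strongConvex` — `F` has a minimiser `x*` on `B̄(0,ρ)`, it lies in the OPEN ball, `DF(x*) = 0`, and `‖x*‖ ≤ ‖DF(0)‖/λ`;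
* ★ `eq_of_fderiv_eq_zero_of_strongConvex` — critical points in `B̄(0,ρ)` are unique; `quadratic_growth_of_strongConvex` — `F(x*) + (λ/2)‖x − x*‖² ≤ F(x)`;
* ★★ `norm_sub_sq_le_of_strongConvex` — STABILITY: if `G` is another such function and `|F − G| ≤ δ` on the ball, their critical points satisfy
  `λ‖a − b‖² ≤ 2δ`;
* ★★★ `continuous_fibreMinimiser` — for `F : M × V → ℝ` JOINTLY CONTINUOUS (`M` any topological space) and strongly convex fibrewise with uniform
  `(λ, ρ)`, ANY selection `p ↦ y*(p)` of fibrewise critical points in `B̄(0,ρ)` is CONTINUOUS (stability + the compact tube lemma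
  `IsCompact.eventually_forall_of_forall_eventually`), hence Borel measurable (`measurable_fibreMinimiser`); ★★ `exists_fibreMinimiser` — such a
  selection exists, with `y*(p)` the fibre minimiser, interior, `DF_p(y*(p)) = 0`, `‖y*(p)‖ ≤ ‖DF_p(0)‖/λ`.

WHY (the use; this seat's memo `w2-g58-memo-24197-fibred-laplace.md` §4 «architecture v2»).  In the window-uniform programme for ⟨24197⟩/⟨24196⟩ the
`6L⁴ − 3` follower variables are integrated fibrewise over ALL near-flat leader configurations `C`; the fibre phase `U ↦ F̂(C, U)` is strongly convex near
`U ≡ 1` (follower gap `λ_F ≥ L^{−k}`, hub-angle independent) with a small gradient at `U ≡ 1` (`≲ L·‖[C,C]‖`), but its minimiser `y*(C)` is NOT `1`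
(followers smear the thin toron's flux).  The fibred core ✓`laplaceMethod_quantitative_fibred_chart_of_taylor` is applied at `y*(C)` through the
left-invariant skew-product chart `Ψ(C,y) = (C, y*(C)·exp y)`, which needs exactly: existence ∕ interiority ∕ criticality of `y*(C)` (this file, §1) and its
measurability in `C` (this file, §3, via continuity).  `f₀(C) = F̂(C, y*(C))` is then the tree-level effective leader potential of the 12-dimensional leader
integral where the cone analysis (M4) takes place.

HONEST FRAMING: classical convex analysis ∕ topology; width 0 by itself toward any lattice statement; no ring deficit is touched; ⟨24197⟩, ⟨24196⟩,
⟨24194⟩, ⟨24497⟩ and every rung ∕ summit statement stay OPEN; own crux ⟨22884⟩ OPEN (blocked-on ⟨19935⟩); the Yang–Mills mass gap is NOT proved; no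
summit is proved by a line.  Width seat ym-line-sfw-p2-w2 g58 (cell ym-idea-1, free hands), `--supports stmt-QuantumFields-24197`.  THEOREMS ONLY
(0 `def`, 0 `sorry`), standard axioms.

## References
* Yu. Nesterov, *Introductory Lectures on Convex Optimization*, Kluwer (2004), Thm 2.1.8 ∕ Def. 2.1.2 (first-order characterisation of strong convexity,
  uniqueness of the minimiser, `‖x − x*‖² ≤ (2/μ)(f(x) − f*)`). [folklore]
* J. F. Bonnans, A. Shapiro, *Perturbation Analysis of Optimization Problems*, Springer (2000), Prop. 4.32 (Lipschitz∕Hölder stability of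
  minimisers under second-order growth). [folklore]
-/

set_option autoImplicit false

noncomputable section

open _root_.Filter _root_.Set _root_.Metric _root_.Topology

namespace Summit.QuantumFields.YangMills.Theorems.QuantitativeLaplace

variable {V : Type*} [NormedAddCommGroup V] [NormedSpace ℝ V]

/-! ## §1 One strongly convex function on a ball -/

/-- ★ **Minimiser of a strongly convex function on a ball with almost-critical centre**: it exists, lies in the OPEN ball, is a critical point,
and `‖x*‖ ≤ ‖DF(0)‖/λ`. [folklore] -/
theorem exists_minimiser_of_strongConvex [FiniteDimensional ℝ V] {F : V → ℝ} {lam ρ : ℝ} (hlam : 0 < lam) (hρ : 0 < ρ)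
    (hcont : ContinuousOn F (closedBall (0 : V) ρ))
    (hsc : ∀ x₀ ∈ closedBall (0 : V) ρ, ∀ x ∈ closedBall (0 : V) ρ,
      F x₀ + fderiv ℝ F x₀ (x - x₀) + lam / 2 * ‖x - x₀‖ ^ 2 ≤ F x)
    (hg : ‖fderiv ℝ F 0‖ < lam * ρ / 2) :
    ∃ xs ∈ ball (0 : V) ρ, IsMinOn F (closedBall (0 : V) ρ) xs ∧ fderiv ℝ F xs = 0 ∧ ‖xs‖ ≤ ‖fderiv ℝ F 0‖ / lam := by
  have hK : IsCompact (closedBall (0 : V) ρ) := isCompact_closedBall 0 ρ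
  have h0 : (0 : V) ∈ closedBall (0 : V) ρ := mem_closedBall_self hρ.le
  obtain ⟨xs, hxs, hmin⟩ := hK.exists_isMinOn ⟨0, h0⟩ hcont
  have hop : |fderiv ℝ F 0 xs| ≤ ‖fderiv ℝ F 0‖ * ‖xs‖ := by
    have := (fderiv ℝ F 0).le_opNorm xs
    rwa [Real.norm_eq_abs] at this
  have habs := neg_abs_le (fderiv ℝ F 0 xs)
  have hxsρ : ‖xs‖ ≤ ρ := mem_closedBall_zero_iff.1 hxs
  -- the minimiser is interior
  have hxs_in : xs ∈ ball (0 : V) ρ := by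
    by_contra hout
    have hge : ρ ≤ ‖xs‖ := by simpa [mem_ball_zero_iff, not_lt] using hout
    have hnorm : ‖xs‖ = ρ := le_antisymm hxsρ hge
    have h1 := hsc 0 h0 xs hxs
    simp only [sub_zero] at h1
    have h2 : F xs ≤ F 0 := hmin h0
    rw [hnorm] at hop h1
    have hDρ : ‖fderiv ℝ F 0‖ * ρ < lam / 2 * ρ ^ 2 := by nlinarith [hg, hρ]
    linarith [h1, h2, hop, habs, hDρ]
  have hloc : IsLocalMin F xs := hmin.isLocalMin (closedBall_mem_nhds_of_mem hxs_in)
  have hcrit : fderiv ℝ F xs = 0 := hloc.fderiv_eq_zero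
  refine ⟨xs, hxs_in, hmin, hcrit, ?_⟩
  -- the a-priori bound
  have h1 := hsc 0 h0 xs hxs
  have h2 := hsc xs hxs 0 h0
  simp only [sub_zero] at h1
  rw [hcrit, zero_apply, zero_sub, norm_neg] at h2
  have h3 : lam * ‖xs‖ ^ 2 ≤ ‖fderiv ℝ F 0‖ * ‖xs‖ := by nlinarith
  by_cases hx0 : xs = 0
  · rw [hx0, norm_zero]; positivity
  · have hpos : 0 < ‖xs‖ := norm_pos_iff.2 hx0
    rw [le_div_iff₀ hlam]
    have h4 : lam * ‖xs‖ * ‖xs‖ ≤ ‖fderiv ℝ F 0‖ * ‖xs‖ := by nlinarith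
    have h5 := le_of_mul_le_mul_right h4 hpos
    linarith

/-- ★ **Quadratic growth at a critical point** of a strongly convex function on the ball. [folklore] -/
theorem quadratic_growth_of_strongConvex {F : V → ℝ} {lam ρ : ℝ}
    (hsc : ∀ x₀ ∈ closedBall (0 : V) ρ, ∀ x ∈ closedBall (0 : V) ρ,
      F x₀ + fderiv ℝ F x₀ (x - x₀) + lam / 2 * ‖x - x₀‖ ^ 2 ≤ F x)
    {xs : V} (hxs : xs ∈ closedBall (0 : V) ρ) (hcrit : fderiv ℝ F xs = 0) {x : V} (hx : x ∈ closedBall (0 : V) ρ) :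
    F xs + lam / 2 * ‖x - xs‖ ^ 2 ≤ F x := by
  have h := hsc xs hxs x hx
  rwa [hcrit, zero_apply, add_zero] at h

/-- ★★ **Stability of critical points under perturbation of the function**: `F`, `G` strongly convex (same `λ`) on `B̄(0,ρ)`, `a`, `b` critical points of
`F`, `G` in the ball, `|F − G| ≤ δ` on the ball ⟹ `λ‖a − b‖² ≤ 2δ`. [folklore] -/
theorem norm_sub_sq_le_of_strongConvex {F G : V → ℝ} {lam ρ δ : ℝ}
    (hscF : ∀ x₀ ∈ closedBall (0 : V) ρ, ∀ x ∈ closedBall (0 : V) ρ,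
      F x₀ + fderiv ℝ F x₀ (x - x₀) + lam / 2 * ‖x - x₀‖ ^ 2 ≤ F x)
    (hscG : ∀ x₀ ∈ closedBall (0 : V) ρ, ∀ x ∈ closedBall (0 : V) ρ,
      G x₀ + fderiv ℝ G x₀ (x - x₀) + lam / 2 * ‖x - x₀‖ ^ 2 ≤ G x)
    {a b : V} (ha : a ∈ closedBall (0 : V) ρ) (hb : b ∈ closedBall (0 : V) ρ)
    (hFa : fderiv ℝ F a = 0) (hGb : fderiv ℝ G b = 0)
    (hFG : ∀ y ∈ closedBall (0 : V) ρ, |F y - G y| ≤ δ) :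
    lam * ‖a - b‖ ^ 2 ≤ 2 * δ := by
  have h1 := quadratic_growth_of_strongConvex hscF ha hFa hb
  have h2 := quadratic_growth_of_strongConvex hscG hb hGb ha
  rw [norm_sub_rev b a] at h1
  have h3 := hFG a ha
  have h4 := hFG b hb
  rw [abs_le] at h3 h4
  nlinarith

/-- ★ **Uniqueness of critical points** of a strongly convex function on the ball (`λ > 0`). [folklore] -/
theorem eq_of_fderiv_eq_zero_of_strongConvex {F : V → ℝ} {lam ρ : ℝ} (hlam : 0 < lam)
    (hsc : ∀ x₀ ∈ closedBall (0 : V) ρ, ∀ x ∈ closedBall (0 : V) ρ,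
      F x₀ + fderiv ℝ F x₀ (x - x₀) + lam / 2 * ‖x - x₀‖ ^ 2 ≤ F x)
    {a b : V} (ha : a ∈ closedBall (0 : V) ρ) (hb : b ∈ closedBall (0 : V) ρ)
    (hFa : fderiv ℝ F a = 0) (hFb : fderiv ℝ F b = 0) : a = b := by
  have h := norm_sub_sq_le_of_strongConvex (δ := 0) hsc hsc ha hb hFa hFb (fun y _ => by simp)
  have h2 : ‖a - b‖ ^ 2 ≤ 0 := by nlinarith
  have h3 : ‖a - b‖ = 0 := by nlinarith [norm_nonneg (a - b), sq_nonneg ‖a - b‖]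
  exact sub_eq_zero.1 (norm_eq_zero.1 h3)

/-! ## §2 A continuous family of strongly convex fibres: the minimiser is continuous in the parameter -/

section Parametric

variable {M : Type*} [TopologicalSpace M]

/-- ★★ **Existence of a fibrewise minimiser selection** with interiority, criticality and the a-priori bound, for a family `F : M × V → ℝ`
continuous and strongly convex on every fibre ball with uniform `(λ, ρ)` and almost-critical centres. [folklore] -/
theorem exists_fibreMinimiser [FiniteDimensional ℝ V] {F : M × V → ℝ} {lam ρ : ℝ} (hlam : 0 < lam) (hρ : 0 < ρ) (hF : Continuous F)
    (hsc : ∀ p, ∀ x₀ ∈ closedBall (0 : V) ρ, ∀ x ∈ closedBall (0 : V) ρ,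
      F (p, x₀) + fderiv ℝ (fun y => F (p, y)) x₀ (x - x₀) + lam / 2 * ‖x - x₀‖ ^ 2 ≤ F (p, x))
    (hg : ∀ p, ‖fderiv ℝ (fun y => F (p, y)) 0‖ < lam * ρ / 2) :
    ∃ ys : M → V, ∀ p, ys p ∈ ball (0 : V) ρ ∧ IsMinOn (fun y => F (p, y)) (closedBall (0 : V) ρ) (ys p) ∧
      fderiv ℝ (fun y => F (p, y)) (ys p) = 0 ∧ ‖ys p‖ ≤ ‖fderiv ℝ (fun y => F (p, y)) 0‖ / lam := by
  have h : ∀ p, ∃ xs ∈ ball (0 : V) ρ, IsMinOn (fun y => F (p, y)) (closedBall (0 : V) ρ) xs ∧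
      fderiv ℝ (fun y => F (p, y)) xs = 0 ∧ ‖xs‖ ≤ ‖fderiv ℝ (fun y => F (p, y)) 0‖ / lam := fun p =>
    exists_minimiser_of_strongConvex hlam hρ ((hF.comp (Continuous.prodMk_right p)).continuousOn) (hsc p) (hg p)
  choose ys hys using h
  exact ⟨ys, fun p => ⟨(hys p).1, (hys p).2⟩⟩

/-- ★★★ **The fibre minimiser is continuous in the parameter.**  `F : M × V → ℝ` jointly continuous, strongly convex on every fibre ball `B̄(0,ρ)` with
uniform `λ > 0`; then ANY selection `p ↦ y*(p) ∈ B̄(0,ρ)` of fibrewise critical points is continuous.  (Stability `λ‖y*(p) − y*(p′)‖² ≤ 2 sup_{B̄}|F_p − F_{p′}|`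
and the compact tube lemma.) [folklore] -/
theorem continuous_fibreMinimiser [FiniteDimensional ℝ V] {F : M × V → ℝ} {lam ρ : ℝ} (hlam : 0 < lam) (hF : Continuous F)
    (hsc : ∀ p, ∀ x₀ ∈ closedBall (0 : V) ρ, ∀ x ∈ closedBall (0 : V) ρ,
      F (p, x₀) + fderiv ℝ (fun y => F (p, y)) x₀ (x - x₀) + lam / 2 * ‖x - x₀‖ ^ 2 ≤ F (p, x))
    {ys : M → V} (hys : ∀ p, ys p ∈ closedBall (0 : V) ρ) (hcrit : ∀ p, fderiv ℝ (fun y => F (p, y)) (ys p) = 0) :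
    Continuous ys := by
  have hK : IsCompact (closedBall (0 : V) ρ) := isCompact_closedBall 0 ρ
  refine continuous_iff_continuousAt.2 fun p => ?_
  rw [ContinuousAt, Metric.tendsto_nhds]
  intro ε hε
  set δ : ℝ := lam * ε ^ 2 / 4 with hδ
  have hδpos : 0 < δ := by positivity
  -- the tube lemma: uniformly on the compact ball, `F (p', ·)` is `δ`-close to `F (p, ·)` for `p'` near `p`
  have hP : ∀ y ∈ closedBall (0 : V) ρ, ∀ᶠ z : M × V in 𝓝 (p, y), |F (z.1, z.2) - F (p, z.2)| < δ := by
    intro y _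
    have hg : Continuous fun z : M × V => F (z.1, z.2) - F (p, z.2) :=
      (hF.comp (continuous_fst.prodMk continuous_snd)).sub (hF.comp ((continuous_const).prodMk continuous_snd))
    have ht : Tendsto (fun z : M × V => F (z.1, z.2) - F (p, z.2)) (𝓝 (p, y)) (𝓝 0) := by
      have := hg.tendsto (p, y)
      simpa using this
    have h1 := Metric.tendsto_nhds.1 ht δ hδpos
    filter_upwards [h1] with z hz
    rwa [Real.dist_eq, sub_zero] at hz
  have htube := hK.eventually_forall_of_forall_eventually (P := fun x y => |F (x, y) - F (p, y)| < δ) hP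
  filter_upwards [htube] with p' hp'
  -- stability between the fibres `p'` and `p`
  have hstab := norm_sub_sq_le_of_strongConvex (δ := δ) (hsc p') (hsc p) (hys p') (hys p) (hcrit p') (hcrit p)
    (fun y hy => (hp' y hy).le)
  rw [dist_eq_norm]
  have h1 : ‖ys p' - ys p‖ ^ 2 < ε ^ 2 := by
    have : lam * ‖ys p' - ys p‖ ^ 2 ≤ lam * ε ^ 2 / 2 := by rw [hδ] at hstab; linarith
    nlinarith
  exact lt_of_pow_lt_pow_left₀ 2 hε.le h1

end Parametric

/-! ## §3 Measurability -/

section Measurable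

variable {M : Type*} [TopologicalSpace M] [MeasurableSpace M] [OpensMeasurableSpace M]
  [MeasurableSpace V] [BorelSpace V]

/-- ★ The fibre minimiser selection is Borel measurable (continuity, §2). [folklore] -/
theorem measurable_fibreMinimiser [FiniteDimensional ℝ V] {F : M × V → ℝ} {lam ρ : ℝ} (hlam : 0 < lam) (hF : Continuous F)
    (hsc : ∀ p, ∀ x₀ ∈ closedBall (0 : V) ρ, ∀ x ∈ closedBall (0 : V) ρ,
      F (p, x₀) + fderiv ℝ (fun y => F (p, y)) x₀ (x - x₀) + lam / 2 * ‖x - x₀‖ ^ 2 ≤ F (p, x))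
    {ys : M → V} (hys : ∀ p, ys p ∈ closedBall (0 : V) ρ) (hcrit : ∀ p, fderiv ℝ (fun y => F (p, y)) (ys p) = 0) :
    Measurable ys :=
  (continuous_fibreMinimiser hlam hF hsc hys hcrit).measurable

end Measurable

end Summit.QuantumFields.YangMills.Theorems.QuantitativeLaplace

end
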